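import Summits.BirchSwinnertonDyer.BirchSwinnertonDyer.Theorems.ThetaPartnerAtTwoSignedKatoUpToAtTwoLocalTwoPlusColemanKernelSigned
import Summits.BirchSwinnertonDyer.BirchSwinnertonDyer.Theorems.ByReductionTypeAtTwoSupersingularFlatColemanClauses
import Literature.NumberTheory.EllipticCurves.PAdicPowerSeriesZeros
import HarnessLib

/-!
# Route `ThetaPartnerAtTwo` (TP2), crux K3 `SignedKatoDivisibilityUpToAtTwo` (item stmt-BirchSwinnertonDyer-20308),
# line `colemanrat` v4 — THE CONVERSE COLEMAN-KERNEL INCLUSION **`ann(E⁺_∞) ⊆ Ker Col♭`** at `a_p = 0` (every prime),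
# by evaluation at `ζ_{p^{2k}} − 1` and the finiteness of the zero set of a non-zero Iwasawa function

Width seat `bsd-wall-tp2-p2x-w3` g2 (cell `bsd-wall`), the brick named «next local brick … unowned» by the K3 lead g3
(bus 2026-08-28T01:09:36Z; `Cruxes/SignedKatoDivisibilityUpToAtTwo/G3-LEAD-v4.md` §5). HONEST FRAMING: THEOREMS ONLY — no definition,
no named fact, no instance, no `sorry`; pure algebra on Sprung's transcription (`pairingSum`, `IsColemanPair`, `colemanKer`) plus the
tree's `p`-adic evaluation of `Λ` on the open unit disc; closes no item; BSD is NOT proved by any of this.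

## The statement and its proof
Let `z : E(K_∞·K_v) → ℤ_p` have a Coleman value `(L♯, L♭)` for a system `c` with `a_p = 0` (`IsColemanPair κ ι W 0 g c z L♯ L♭`:
`ω_n ∣ P_{n,c_n}(z) + u_n L♯ + v_n L♭` for all `n`). If `z` kills the `g`-orbit of every EVEN-level point `c_{2k}`, `k ≥ 1` — in
particular if `z` kills Kobayashi's `E⁺(K_{2k}·K_v) ∋ c_{2k}` — then **`L♭ = 0`**, i.e. `z ∈ Ker Col♭`:
at level `2k`, `P_{2k}(z) = 0` and `u_{2k} = 0` (`a_p = 0`), so `ω_{2k} ∣ v_{2k} · L♭` in `Λ = ℤ_p⟦T⟧`; evaluating at `ζ − 1`,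
`ζ ∈ ℂ_p` of exact order `p^{2k}` (`|ζ − 1| < 1`, evaluation is multiplicative on bounded power series, `ω_{2k}(ζ − 1) = 0`), and using
`v_{2k}(ζ − 1) = ± ∏_{i<k} Φ_{p^{2i+1}}(ζ) ≠ 0` (only ODD-index cyclotomic factors), every such `ζ − 1` is a zero of `L♭` in the open
unit disc — infinitely many, so `L♭ = 0` (`MemIwasawaRat.finite_setOf_hasSum_zero`). This is the converse of file 14/15's
«`Ker Col♭ ⊆ ann(E⁺)`» (lead g3): together, **`Ker Col♭ = ann(E⁺_∞)` at `p = 2`** granted HONDA⁺@2's (GEN) clauses (§5), which is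
what makes `P := Hom(E_∞, ℤ₂)/ann(E⁺_∞)`, `ι := Col♭` an INJECTIVE Coleman map on the points model (clause (Col) of (R2) with `m = 0`).

## What is proved
* §1 (`Λ = ℤ_p⟦T⟧`, any `p`) `hasSum_coeff_toIwasawa_mul` (evaluation of `P·G`, `P ∈ ℤ[T]`), `eval₂_cyclotomicOmega_eq_zero`,
  `hasSum_coeff_zero_of_cyclotomicOmega_dvd_toIwasawa_mul` (`ω_n ∣ v·L`, `v(ζ−1) ≠ 0` ⟹ `L(ζ−1) = 0`),
  `eq_zero_of_forall_even_hasSum_zero` (zeros at all `ζ_{p^{2k}} − 1`, `k ≥ 1` ⟹ `L = 0`).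
* §2 `eval_cyclotomic_odd_pow_ne_zero_of_isPrimitiveRoot_even`, `eval₂_flatPoly_zero_two_mul_ne_zero` (`v_{2k}(ζ − 1) ≠ 0`).
* §3 (any `K, p, κ, E, ι, W, g, c`) `pairingSum_eq_zero_of_forall_evalOn_eq_zero`,
  **`flat_eq_zero_of_isColemanPair_of_pairingSum_even_eq_zero`**, `flat_eq_zero_of_isColemanPair_of_forall_evalOn_eq_zero`,
  `mem_colemanKer_flat_of_isColemanPair_of_forall_evalOn_eq_zero`.
* §4 (signed) `flat_eq_zero_of_isColemanPair_of_forall_signed`, **`mem_colemanKer_flat_of_forall_signedPlus_of_trace`**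
  (`ann(E⁺_∞) ⊆ Ker Col♭` for every (L)(TR)-system `d`, values by `SSFlatEC.exists_isColemanPair_of_trace`).
* §5 (`p = 2`, HONDA⁺@2 (GEN)(GEN₀) granted, with file 15) **`mem_colemanKer_flat_iff_forall_signedPlus_two_of_honda`**:
  `Ker Col♭ = ann(E⁺(ℚ_{2,∞}·ℚ₂))`.

References: [Kobayashi2003] Thm. 6.2, Prop. 8.12 i), Prop. 8.18–8.23; [Sprung2012] Def. 3.1, 5.9, 7.1, 7.9, p. 1485; [Sprung2017] §4
Cor. 4.4 (`u_{2k} = 0`, `v_{2k+1} = 0` at `a_p = 0`); [Pollack2003] Lemma 4.7; [Lang1990] Ch. 5 §2 Thm. 2.2; [Washington1997] Thm. 7.3.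
-/

set_option autoImplicit false
-- the Theorems namespace of this sub repeats the summit name by design (D-0017 nested layout)
set_option linter.dupNamespace false

noncomputable section

open scoped Classical

namespace Summit.BirchSwinnertonDyer.BirchSwinnertonDyer.Theorems

namespace SignedKatoOffTwo.ColemanConverse

open Polynomial Literature.NumberTheory.EllipticCurves Literature.NumberTheory.GaloisRepresentations
  Literature.NumberTheory.EllipticCurves.ZpExtension Literature.NumberTheory.EllipticCurves.Kobayashi2003
  Literature.NumberTheory.EllipticCurves.Sprung2017 Literature.NumberTheory.EllipticCurves.Sprung2012

universe u

/-! ## §1 Evaluating `Λ = ℤ_p⟦T⟧` at `ζ − 1` -/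

section Eval

variable {p : ℕ} [hp : Fact p.Prime]

/-- **Evaluation of `P · G` on the open unit disc** (`P ∈ ℤ[T]`, `G ∈ Λ`, `|z| < 1` in `ℂ_p`): `∑_k (P G)_k z^k = P(z) · G(z)`,
`G(z) = ∑_k g_k z^k` — evaluation of bounded power series is multiplicative (`tsum_map_coeff_mul_mul_pow`).
[cite: Washington1997, §7.1–7.2] -/
theorem hasSum_coeff_toIwasawa_mul (P : ℤ[X]) (G : IwasawaAlgebra p) {z : ℂ_[p]} (hz : ‖z‖ < 1) :
    HasSum (fun k ↦ ((algebraMap ℚ_[p] ℂ_[p]).comp (algebraMap ℤ_[p] ℚ_[p])) (PowerSeries.coeff k (toIwasawa p P * G)) * z ^ k)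
      (P.eval₂ (algebraMap ℤ ℂ_[p]) z *
        ∑' k, ((algebraMap ℚ_[p] ℂ_[p]).comp (algebraMap ℤ_[p] ℚ_[p])) (PowerSeries.coeff k G) * z ^ k) := by
  set ιZ : ℤ_[p] →+* ℂ_[p] := (algebraMap ℚ_[p] ℂ_[p]).comp (algebraMap ℤ_[p] ℚ_[p]) with hιZ
  have hbd : ∀ (A : PowerSeries ℤ_[p]) (k : ℕ), ‖ιZ (PowerSeries.coeff k A)‖ ≤ 1 := norm_algebraMap_coeff_le_one
  rw [show toIwasawa p P = ((P.map (Int.castRingHom ℤ_[p]) : ℤ_[p][X]) : PowerSeries ℤ_[p]) from rfl]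
  have hs : Summable fun k ↦ ιZ (PowerSeries.coeff k
      (((P.map (Int.castRingHom ℤ_[p]) : ℤ_[p][X]) : PowerSeries ℤ_[p]) * G)) * z ^ k :=
    summable_map_coeff_mul_pow ιZ (hbd _) hz
  have h1 := hs.hasSum
  rw [tsum_map_coeff_mul_mul_pow ιZ (hbd _) (hbd _) hz, (hasSum_map_coeff_coe_mul_pow ιZ _ z).tsum_eq, Polynomial.eval₂_map,
    RingHom.ext_int (ιZ.comp (Int.castRingHom ℤ_[p])) (algebraMap ℤ ℂ_[p])] at h1
  exact h1

/-- `ω_n(ζ − 1) = ζ^{pⁿ} − 1 = 0` for `ζ^{pⁿ} = 1`. [folklore] -/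
theorem eval₂_cyclotomicOmega_eq_zero (n : ℕ) {ζ : ℂ_[p]} (hζ : ζ ^ p ^ n = 1) :
    (cyclotomicOmega p n).eval₂ (algebraMap ℤ ℂ_[p]) (ζ - 1) = 0 := by
  rw [cyclotomicOmega, eval₂_sub, eval₂_pow, eval₂_add, eval₂_X, eval₂_one, sub_add_cancel, hζ, sub_self]

/-- **`ω_n ∣ v · L` with `v(ζ − 1) ≠ 0` forces `L(ζ − 1) = 0`** (`ζ^{pⁿ} = 1`, `v ∈ ℤ[T]`, `L ∈ Λ`): evaluate `v L = ω_n q` at `ζ − 1`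
(`|ζ − 1| < 1`): `v(ζ−1) L(ζ−1) = ω_n(ζ−1) q(ζ−1) = 0`. [cite: Pollack2003, Prop. 6.18 (proof) and Lemma 4.7] [cite: Washington1997, §7.2] -/
theorem hasSum_coeff_zero_of_cyclotomicOmega_dvd_toIwasawa_mul {n : ℕ} {v : ℤ[X]} {L : IwasawaAlgebra p}
    (h : toIwasawa p (cyclotomicOmega p n) ∣ toIwasawa p v * L) {ζ : ℂ_[p]} (hζ : ζ ^ p ^ n = 1)
    (hv : v.eval₂ (algebraMap ℤ ℂ_[p]) (ζ - 1) ≠ 0) :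
    HasSum (fun k ↦ ((algebraMap ℚ_[p] ℂ_[p]).comp (algebraMap ℤ_[p] ℚ_[p])) (PowerSeries.coeff k L) * (ζ - 1) ^ k) 0 := by
  have hz : ‖ζ - 1‖ < 1 := norm_sub_one_lt_one_of_pow_prime_pow_eq_one hζ
  obtain ⟨q, hq⟩ := h
  have hL := hasSum_coeff_toIwasawa_mul v L hz
  have hR := hasSum_coeff_toIwasawa_mul (cyclotomicOmega p n) q hz
  rw [eval₂_cyclotomicOmega_eq_zero n hζ, zero_mul, ← hq] at hR
  have heq := hL.unique hR
  have htsum : ∑' k, ((algebraMap ℚ_[p] ℂ_[p]).comp (algebraMap ℤ_[p] ℚ_[p])) (PowerSeries.coeff k L) * (ζ - 1) ^ k = 0 :=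
    (mul_eq_zero.mp heq).resolve_left hv
  have hs := (summable_map_coeff_mul_pow _ (norm_algebraMap_coeff_le_one L) hz).hasSum
  rwa [htsum] at hs

/-- **An Iwasawa function vanishing at `ζ − 1` for ζ of every even exact order `p^{2k}`, `k ≥ 1`, is `0`**: these are infinitely many
zeros in the open unit disc (`orderOf ζ = p^{2k}` recovers `k`), against `MemIwasawaRat.finite_setOf_hasSum_zero`.
[cite: Lang1990, Ch. 5 §2 Thm. 2.2] [cite: Washington1997, Thm. 7.3] -/
theorem eq_zero_of_forall_even_hasSum_zero {L : IwasawaAlgebra p}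
    (h : ∀ (k : ℕ), 1 ≤ k → ∀ (ζ : ℂ_[p]), IsPrimitiveRoot ζ (p ^ (2 * k)) →
      HasSum (fun i ↦ ((algebraMap ℚ_[p] ℂ_[p]).comp (algebraMap ℤ_[p] ℚ_[p])) (PowerSeries.coeff i L) * (ζ - 1) ^ i) 0) :
    L = 0 := by
  by_contra hL
  set Z : Set ℂ_[p] := {x : ℂ_[p] | ‖x‖ < 1 ∧
    HasSum (fun i ↦ algebraMap ℚ_[p] ℂ_[p] (PowerSeries.coeff i (iwasawaToPowerSeries p L)) * x ^ i) 0} with hZ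
  have hZfin : Z.Finite :=
    MemIwasawaRat.finite_setOf_hasSum_zero (memIwasawaRat_iwasawaToPowerSeries p L)
      (fun h0 ↦ hL (iwasawaToPowerSeries_injective p (by rw [h0, map_zero])))
  have hcoe : ∀ i : ℕ, algebraMap ℚ_[p] ℂ_[p] (PowerSeries.coeff i (iwasawaToPowerSeries p L)) =
      ((algebraMap ℚ_[p] ℂ_[p]).comp (algebraMap ℤ_[p] ℚ_[p])) (PowerSeries.coeff i L) := by
    intro i
    simp only [RingHom.comp_apply, iwasawaToPowerSeries, PowerSeries.coeff_map]
  have hsub : Set.range (fun j : ℕ ↦ p ^ (2 * (j + 1))) ⊆ (fun x : ℂ_[p] ↦ orderOf (1 + x)) '' Z := by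
    rintro _ ⟨j, rfl⟩
    have hpos : 0 < p ^ (2 * (j + 1)) := pow_pos hp.out.pos _
    obtain ⟨ζ, hζr⟩ := IsAlgClosed.exists_root (cyclotomic (p ^ (2 * (j + 1))) ℂ_[p])
      (degree_cyclotomic_pos (p ^ (2 * (j + 1))) ℂ_[p] hpos).ne'
    have hζ : IsPrimitiveRoot ζ (p ^ (2 * (j + 1))) := (isRoot_cyclotomic_iff_charZero hpos).mp hζr
    have hz1 : ‖ζ - 1‖ < 1 := norm_sub_one_lt_one_of_pow_prime_pow_eq_one hζ.pow_eq_one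
    have h0 := h (j + 1) (by omega) ζ hζ
    refine ⟨ζ - 1, ⟨hz1, ?_⟩, ?_⟩
    · simpa only [hcoe] using h0
    · dsimp only
      rw [add_sub_cancel, ← hζ.eq_orderOf]
  have hinj : Function.Injective (fun j : ℕ ↦ p ^ (2 * (j + 1))) := by
    intro j j' hjj
    have := Nat.pow_right_injective hp.out.two_le hjj
    omega
  exact (Set.infinite_range_of_injective hinj) ((hZfin.image _).subset hsub)

end Eval

/-! ## §2 `v_{2k}(ζ − 1) ≠ 0` for `ζ` of exact order `p^{2m}` -/

section FlatPoly

variable {p : ℕ} [hp : Fact p.Prime]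

/-- `Φ_{p^{2i+1}}(ζ) ≠ 0` for `ζ ∈ ℂ_p` of exact order `p^{2m}`: a root of `Φ_{p^{2i+1}}` has exact order `p^{2i+1} ≠ p^{2m}`.
[cite: Pollack2003, Lemma 4.7] -/
theorem eval_cyclotomic_odd_pow_ne_zero_of_isPrimitiveRoot_even {m : ℕ} {ζ : ℂ_[p]} (hζ : IsPrimitiveRoot ζ (p ^ (2 * m)))
    (i : ℕ) : (cyclotomic (p ^ (2 * i + 1)) ℂ_[p]).eval ζ ≠ 0 := by
  intro hroot
  have hprim : IsPrimitiveRoot ζ (p ^ (2 * i + 1)) := (isRoot_cyclotomic_iff_charZero (pow_pos hp.out.pos _)).mp hroot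
  have heq : p ^ (2 * i + 1) = p ^ (2 * m) := hprim.eq_orderOf.trans hζ.eq_orderOf.symm
  have := Nat.pow_right_injective hp.out.two_le heq
  omega

/-- **`v_{2k}(ζ − 1) ≠ 0`** at `a_p = 0` whenever no ODD-index `Φ_{p^{2i+1}}` vanishes at `ζ`: `v_0 = 1`,
`v_{2k+2} = −Φ_{p^{2k+1}}(1+T) · v_{2k}` (`v_{n+2} = a_p v_{n+1} − Φ_{p^{n+1}}(1+T) v_n`), so
`v_{2k}(ζ − 1) = ± ∏_{i<k} Φ_{p^{2i+1}}(ζ)`. [cite: Sprung2017, §4 Cor. 4.4 (the case a_p = 0)] [cite: Pollack2003, Lemma 4.7] -/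
theorem eval₂_flatPoly_zero_two_mul_ne_zero {ζ : ℂ_[p]} (hζ : ∀ i : ℕ, (cyclotomic (p ^ (2 * i + 1)) ℂ_[p]).eval ζ ≠ 0) (k : ℕ) :
    (flatPoly 0 p (2 * k)).eval₂ (algebraMap ℤ ℂ_[p]) (ζ - 1) ≠ 0 := by
  induction k with
  | zero => rw [Nat.mul_zero, flatPoly_zero, eval₂_one]; exact one_ne_zero
  | succ k ih =>
    rw [show 2 * (k + 1) = 2 * k + 2 by ring, flatPoly_add_two, Polynomial.C_0, zero_mul, zero_sub, eval₂_neg, eval₂_mul,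
      neg_ne_zero, eval₂_comp, eval₂_add, eval₂_X, eval₂_one, sub_add_cancel, eval₂_eq_eval_map, map_cyclotomic]
    exact mul_ne_zero (hζ k) ih

end FlatPoly

/-! ## §3 The converse: killing the even-level orbits forces `L♭ = 0` -/

section Converse

variable {K : Type u} [Field K] {p : ℕ} [hp : Fact p.Prime] {κ : ZpExtension K p}
variable {E : Type u} [Field E] [Algebra K E] {ι : AlgebraicClosure K →ₐ[K] AlgebraicClosure E}
variable {W : WeierstrassCurve K}

/-- `P_{n,x}(z) = 0` when `z` (read through `evalOn`) kills the orbit `{gʲ x : j < pⁿ}`. [cite: Sprung2012, Def. 3.1 (p. 1489)] -/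
theorem pairingSum_eq_zero_of_forall_evalOn_eq_zero {A : AddSubgroup (localPoints W E)} {g : Field.absoluteGaloisGroup E} {n : ℕ}
    {x : localPoints W E} {z : A →+ ℤ_[p]} (h : ∀ j, j < p ^ n → evalOn W A z (g ^ j • x) = 0) :
    pairingSum W A g n x z = 0 := by
  rw [pairingSum_def]
  exact Finset.sum_eq_zero fun j hj ↦ by rw [h j (Finset.mem_range.mp hj), map_zero, zero_mul]

/-- **THE CONVERSE COLEMAN-KERNEL INCLUSION, pairing form** (`a_p = 0`, every prime, any data): if `(L♯, L♭)` is a Coleman value of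
`z` for the system `c` and the even-level pairings `P_{2k, c_{2k}}(z)` vanish for all `k ≥ 1`, then **`L♭ = 0`**. At level `2k`:
`ω_{2k} ∣ v_{2k} L♭` (`u_{2k} = 0`); evaluate at `ζ − 1`, `ζ` of exact order `p^{2k}` (§1, `v_{2k}(ζ−1) ≠ 0` by §2): `L♭(ζ − 1) = 0`
for infinitely many points of the open unit disc, so `L♭ = 0`. [cite: Sprung2012, Def. 5.9, Def. 7.1 and p. 1485 («Col♭ = Col⁺ at a_p = 0»)]
[cite: Kobayashi2003, Thm. 6.2 and Prop. 8.18–8.23] [cite: Sprung2017, §4 Cor. 4.4] -/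
theorem flat_eq_zero_of_isColemanPair_of_pairingSum_even_eq_zero {g : Field.absoluteGaloisGroup E} {c : ℕ → localPoints W E}
    {z : localTowerPointsOfEmb κ ι W →+ ℤ_[p]} {Lsharp Lflat : IwasawaAlgebra p} (h : IsColemanPair κ ι W 0 g c z Lsharp Lflat)
    (hz : ∀ k, 1 ≤ k → pairingSum W (localTowerPointsOfEmb κ ι W) g (2 * k) (c (2 * k)) z = 0) :
    Lflat = 0 := by
  refine eq_zero_of_forall_even_hasSum_zero fun k hk ζ hζ ↦ ?_
  have hn := h (2 * k)
  rw [hz k hk, zero_add, SignedKatoOffTwo.LocalTwo.sharpPoly_zero_of_even, map_zero, zero_mul, zero_add] at hn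
  exact hasSum_coeff_zero_of_cyclotomicOmega_dvd_toIwasawa_mul hn hζ.pow_eq_one
    (eval₂_flatPoly_zero_two_mul_ne_zero (eval_cyclotomic_odd_pow_ne_zero_of_isPrimitiveRoot_even hζ) k)

/-- **Converse, orbit form**: if `z` kills `gʲ • c_{2k}` for all `k ≥ 1`, `j < p^{2k}`, then `L♭ = 0`.
[cite: Sprung2012, Def. 3.1, Def. 5.9, Def. 7.1] [cite: Kobayashi2003, Thm. 6.2] -/
theorem flat_eq_zero_of_isColemanPair_of_forall_evalOn_eq_zero {g : Field.absoluteGaloisGroup E} {c : ℕ → localPoints W E}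
    {z : localTowerPointsOfEmb κ ι W →+ ℤ_[p]} {Lsharp Lflat : IwasawaAlgebra p} (h : IsColemanPair κ ι W 0 g c z Lsharp Lflat)
    (hz : ∀ k, 1 ≤ k → ∀ j, j < p ^ (2 * k) → evalOn W (localTowerPointsOfEmb κ ι W) z (g ^ j • c (2 * k)) = 0) :
    Lflat = 0 :=
  flat_eq_zero_of_isColemanPair_of_pairingSum_even_eq_zero h fun k hk ↦ pairingSum_eq_zero_of_forall_evalOn_eq_zero (hz k hk)

/-- **Converse, kernel form**: a functional with a Coleman value that kills the even-level orbits lies in `Ker Col♭`.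
[cite: Sprung2012, Def. 7.9 (p. 1503)] [cite: Kobayashi2003, Thm. 6.2] -/
theorem mem_colemanKer_flat_of_isColemanPair_of_forall_evalOn_eq_zero {g : Field.absoluteGaloisGroup E} {c : ℕ → localPoints W E}
    {z : localTowerPointsOfEmb κ ι W →+ ℤ_[p]} {Lsharp Lflat : IwasawaAlgebra p} (h : IsColemanPair κ ι W 0 g c z Lsharp Lflat)
    (hz : ∀ k, 1 ≤ k → ∀ j, j < p ^ (2 * k) → evalOn W (localTowerPointsOfEmb κ ι W) z (g ^ j • c (2 * k)) = 0) :
    z ∈ colemanKer κ ι W 0 g c .flat := by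
  rw [mem_colemanKer_iff]
  exact ⟨Lsharp, Lflat, h, flat_eq_zero_of_isColemanPair_of_forall_evalOn_eq_zero h hz⟩

/-! ## §4 Signed form: `ann(E^ε) ⊆ Ker Col♭` when the even-level points lie in `E^ε` -/

/-- **`L♭ = 0` for a functional killing `E^ε(K_{2k}·K_v) ∋ c_{2k}`** (`k ≥ 1`): the `Γ_{K_v}`-orbit of `c_{2k}` stays in
`E^ε(K_{2k}·K_v)` (`SignedEC.closure_orbit_le_signedLocalPointsOfEmb`). [cite: Kobayashi2003, Prop. 8.12 i) (p. 17), Thm. 6.2] -/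
theorem flat_eq_zero_of_isColemanPair_of_forall_signed (ε : ℤˣ) {g : Field.absoluteGaloisGroup E} {c : ℕ → localPoints W E}
    {z : localTowerPointsOfEmb κ ι W →+ ℤ_[p]} {Lsharp Lflat : IwasawaAlgebra p} (h : IsColemanPair κ ι W 0 g c z Lsharp Lflat)
    (hc : ∀ k, 1 ≤ k → c (2 * k) ∈ signedLocalPointsOfEmb κ ι W ε (2 * k))
    (hz : ∀ (n : ℕ) (x : localPoints W E) (hx : x ∈ signedLocalPointsOfEmb κ ι W ε n),
      z ⟨x, localLayerPointsOfEmb_le_localTowerPointsOfEmb κ ι W n (signedLocalPointsOfEmb_le κ ι W ε n hx)⟩ = 0) :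
    Lflat = 0 := by
  refine flat_eq_zero_of_isColemanPair_of_forall_evalOn_eq_zero h fun k hk j _ ↦ ?_
  have hmem : g ^ j • c (2 * k) ∈ signedLocalPointsOfEmb κ ι W ε (2 * k) :=
    SignedEC.closure_orbit_le_signedLocalPointsOfEmb W κ ι ε (2 * k) (hc k hk) (AddSubgroup.subset_closure ⟨g ^ j, rfl⟩)
  rw [evalOn_of_mem W _ z (localLayerPointsOfEmb_le_localTowerPointsOfEmb κ ι W _ (signedLocalPointsOfEmb_le κ ι W ε _ hmem))]
  exact hz (2 * k) _ hmem

/-- **`ann(E⁺_∞) ⊆ Ker Col♭`** — the converse of file 15, for EVERY system `d` with (L) `d_m ∈ E(K_m·K_v)` and (TR)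
`Tr_{m+2/m+1} d_{m+2} = −d_m` (a Honda system with `a_p = 0`), any prime, any `K`, any `ι`, and a local lift `g` of the
topological generator: a functional `z` on `E(K_∞·K_v)` vanishing on `signedLocalPointsOfEmb κ ι W 1 n` for every `n` lies in
`Ker Col♭` — Coleman values exist (`SSFlatEC.exists_isColemanPair_of_trace`), `d_{2k} ∈ E⁺(K_{2k}·K_v)`
(`SignedEC.d_even_mem_signedLocalPointsOfEmb_one`), and §3 applies. With file 15 this is «`Ker Col♭ = ann(E⁺)`» = Kobayashi's
«`ker Col⁺`-duality `H¹_+ = (E⁺ ⊗ ℚ_p/ℤ_p)^⊥`» (Prop. 8.18–8.23 / Thm. 6.2) at `a_p = 0` in Sprung's convention.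
[cite: Kobayashi2003, Thm. 6.2, Prop. 8.12 i), Prop. 8.18–8.23] [cite: Sprung2012, Thm. 2.2 (2′), Def. 5.9, Def. 7.9, p. 1485] -/
theorem mem_colemanKer_flat_of_forall_signedPlus_of_trace {g : Field.absoluteGaloisGroup E} (hg : κ.IsTopGenerator (resGalOfEmb ι g))
    {d : ℕ → localPoints W E} (hd : ∀ m, d m ∈ localLayerPointsOfEmb κ ι W m)
    (htr : ∀ m, localTraceOfEmb κ ι W (m + 1) (m + 2) (d (m + 2)) = -d m)
    {z : localTowerPointsOfEmb κ ι W →+ ℤ_[p]}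
    (hz : ∀ (n : ℕ) (x : localPoints W E) (hx : x ∈ signedLocalPointsOfEmb κ ι W 1 n),
      z ⟨x, localLayerPointsOfEmb_le_localTowerPointsOfEmb κ ι W n (signedLocalPointsOfEmb_le κ ι W 1 n hx)⟩ = 0) :
    z ∈ colemanKer κ ι W 0 g d .flat := by
  have hTr : ∀ n, 1 ≤ n → localTraceOfEmb κ ι W n (n + 1) (d (n + 1)) = (0 : ℤ) • d n - d (n - 1) := by
    intro n hn
    obtain ⟨m, rfl⟩ := Nat.exists_eq_add_of_le' hn
    rw [zero_smul, zero_sub, show m + 1 + 1 = m + 2 by ring, htr m, Nat.add_sub_cancel]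
  obtain ⟨Lsharp, Lflat, h⟩ := SSFlatEC.exists_isColemanPair_of_trace κ ι W hg (dvd_zero (p : ℤ)) hd hTr z
  rw [mem_colemanKer_iff]
  exact ⟨Lsharp, Lflat, h, flat_eq_zero_of_isColemanPair_of_forall_signed 1 h
    (fun k _ ↦ SignedEC.d_even_mem_signedLocalPointsOfEmb_one W κ ι d hd htr k) hz⟩

end Converse

/-! ## §5 `p = 2`: `Ker Col♭ = ann(E⁺(ℚ_{2,∞}·ℚ₂))` granted HONDA⁺@2's generation clauses -/

section Two

open Literature.NumberTheory.EllipticCurves.Rank1Residual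

/-- **`Ker Col♭ = ann(E⁺(ℚ_{2,n}·ℚ₂))` at `p = 2`** for the `ℤ₂`-tower system `d` of files 12–13 ((L), (TR)) granted the generation
clauses (GEN), (GEN₀) of HONDA⁺@2 (K4's `stub_plusHondaSystemTwo`), no `2`-torsion in `E(ℚ_{2,∞}·ℚ₂)` and a local lift `g` of the
topological generator: `z ∈ Ker Col♭ ↔ z` vanishes on `signedLocalPointsOfEmb κ ι W 1 n` for all `n`. (→) is file 15
(`colemanKer_flat_annihilates_signedPlus_two_of_honda`, uses (GEN)); (←) is §4 (uses nothing beyond (L)(TR)).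
[cite: Kobayashi2003, Thm. 6.2, Prop. 8.12, Prop. 8.18–8.23] [cite: Sprung2012, Thm. 2.2 (2′), Def. 7.9, p. 1485] -/
theorem mem_colemanKer_flat_iff_forall_signedPlus_two_of_honda (W : WeierstrassCurve ℚ) {κ : ZpExtension ℚ 2} (hκ : κ.IsCyclotomic)
    (ι : AlgebraicClosure ℚ →ₐ[ℚ] AlgebraicClosure ℚ_[2])
    (hnt : ∀ P ∈ localTowerPointsOfEmb κ ι W, 2 • P = 0 → P = 0)
    {g : Field.absoluteGaloisGroup ℚ_[2]} (hg : κ.IsTopGenerator (resGalOfEmb ι g))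
    {d : ℕ → localPoints W ℚ_[2]} (hd : ∀ m, d m ∈ localLayerPointsOfEmb κ ι W m)
    (htr : ∀ m, localTraceOfEmb κ ι W (m + 1) (m + 2) (d (m + 2)) = -d m)
    (hgen : ∀ m : ℕ, 1 ≤ m → ∀ P ∈ localLayerPointsOfEmb κ ι W m,
      ∃ B ∈ AddSubgroup.closure (Set.range fun σ : Field.absoluteGaloisGroup ℚ_[2] ↦ σ • d m),
        ∃ P' ∈ localLayerPointsOfEmb κ ι W (m - 1), ∃ R ∈ localLayerPointsOfEmb κ ι W m, P = B + P' + 2 • R)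
    (hgen0 : ∀ P ∈ localLayerPointsOfEmb κ ι W 0, ∃ a : ℤ, ∃ R ∈ localLayerPointsOfEmb κ ι W 0, P = a • d 0 + 2 • R)
    (z : localTowerPointsOfEmb κ ι W →+ ℤ_[2]) :
    z ∈ colemanKer κ ι W 0 g d .flat ↔
      ∀ (n : ℕ) (x : localPoints W ℚ_[2]) (hx : x ∈ signedLocalPointsOfEmb κ ι W 1 n),
        z ⟨x, localLayerPointsOfEmb_le_localTowerPointsOfEmb κ ι W n (signedLocalPointsOfEmb_le κ ι W 1 n hx)⟩ = 0 :=
  ⟨fun hz n x hx ↦ SignedKatoOffTwo.LocalTwo.colemanKer_flat_annihilates_signedPlus_two_of_honda W hκ ι hnt hg hd htr hgen hgen0 hz n x hx,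
    fun hz ↦ mem_colemanKer_flat_of_forall_signedPlus_of_trace hg hd htr hz⟩

/-- **The same on K3's habitat with the tower points CONSTRUCTED** (`W/ℚ` globally minimal, `GoodSS W 2`, `a₂(W) = 0`, cyclotomic `κ`,
every `ι`, a local lift `g`): there is `d` with (L)(TR)(NONDIV) (file 13 `plusPointsLayer_two_clauses`) such that every functional
on `E(ℚ_{2,∞}·ℚ₂)` killing all `E⁺(ℚ_{2,n}·ℚ₂)` lies in `Ker Col♭` for `d` — unconditionally (no (GEN) needed in this direction).
[cite: Kobayashi2003, Thm. 6.2, Prop. 8.12] [cite: Sprung2012, Thm. 2.2 (2′), Def. 7.9] -/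
theorem exists_tower_ann_signedPlus_le_colemanKer_flat_two (W : WeierstrassCurve ℚ) [W.IsElliptic] [W.IsGloballyMinimal]
    (hss : GoodSS W 2) (ha : W.frobeniusTrace 2 = 0) (κ : ZpExtension ℚ 2) (hκ : κ.IsCyclotomic)
    (ι : AlgebraicClosure ℚ →ₐ[ℚ] AlgebraicClosure ℚ_[2]) {g : Field.absoluteGaloisGroup ℚ_[2]} (hg : κ.IsTopGenerator (resGalOfEmb ι g)) :
    ∃ d : ℕ → localPoints W ℚ_[2],
      (∀ m, d m ∈ localLayerPointsOfEmb κ ι W m) ∧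
      (∀ m, localTraceOfEmb κ ι W (m + 1) (m + 2) (d (m + 2)) = -d m) ∧
      (∀ b ∈ localLayerPointsOfEmb κ ι W 0, d 0 ≠ 2 • b) ∧
      ∀ z : localTowerPointsOfEmb κ ι W →+ ℤ_[2],
        (∀ (n : ℕ) (x : localPoints W ℚ_[2]) (hx : x ∈ signedLocalPointsOfEmb κ ι W 1 n),
          z ⟨x, localLayerPointsOfEmb_le_localTowerPointsOfEmb κ ι W n (signedLocalPointsOfEmb_le κ ι W 1 n hx)⟩ = 0) →
        z ∈ colemanKer κ ι W 0 g d .flat := by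
  obtain ⟨d, hL, hTR, hND⟩ := SignedKatoOffTwo.LocalTwo.plusPointsLayer_two_clauses W hss ha κ hκ ι
  exact ⟨d, hL, hTR, hND, fun z hz ↦ mem_colemanKer_flat_of_forall_signedPlus_of_trace hg hL hTR hz⟩

end Two

end SignedKatoOffTwo.ColemanConverse

end Summit.BirchSwinnertonDyer.BirchSwinnertonDyer.Theorems

end
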